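import Summits.HodgeConjecture.CorCM.GaloisSixteenClassification
import Summits.HodgeConjecture.CorCM.GaloisTwoPowerDescentStructure
import HarnessLib

/-!
# Degree `32`: the order-`16` classification pulled back along every central involution `t ≠ c`

COR-CM (cell `pub-hodgecm2`), binder seat b04 (gen 36), count-neutral own lane «Galois-CM-type classification».  KERNEL ONLY:
theorems; no definition, no named fact, no `sorry`.  `HC_CM` is neither used nor claimed.  First file of the ORDER-`32` BASE
programme (A7-JUNCTION gen-36 addendum): the `2`-power classification «GOOD ⟺ `Gal ∈ {C, Q, C × C₂, Q × C₂}`» is a theorem in every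
degree `2^n ≥ 32` modulo its base STRUCT(`32`) (`CorCM/GaloisTwoPowerClassification`); the base is attacked by pulling the UNIFORM
degree-`16` classification (`CorCM/GaloisSixteenClassification`, gen 17) back along the CM quotients `K^⟨t⟩`.

GOOD = every primitive CM type nondegenerate.  Let `K` be a GOOD Galois CM field of degree `32`, `c` its complex conjugation and
`t ∈ Gal(K/ℚ)` a CENTRAL INVOLUTION, `t ∉ {1, c}`.  Then `N = ⟨t⟩ ◁ Gal(K/ℚ)`, `c ∉ N`, `K' = K^N` is a Galois CM field of degree
`16`, GOOD by monotonicity (`CorCM/GaloisDegenerateMonotone`, gen 32), so `GOOD16(Gal(K'/ℚ), c')` holds (gen 17):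
`(∀ g', g'² ∈ {1, c'}) ∨ (∃ r' of order 8, r'⁴ = c', all conjugates of r' in {r', r'⁻¹})`.  Pulled back along the restriction
map `res : Gal(K/ℚ) ↠ Gal(K'/ℚ)` (kernel `N = {1, t}`, `res c = c'`):

* **`sq_mem_or_exists_order_eight_of_central_involution`** — EITHER every `g ∈ Gal(K/ℚ)` has `g² ∈ {1, c, t, c t}`, OR there is
  `r ∈ Gal(K/ℚ)` of order `8` with `r⁴ ∈ {c, c t}` all of whose conjugates lie in `{r, r⁻¹, r t, r⁻¹ t}`.
* `sq_eq_one_or_eq_of_two_central_involutions` — if `Gal(K/ℚ)` has exponent `4` (so the second alternative is void) and two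
  central involutions `t₁, t₂` with `c, t₁, t₂` independent, all squares lie in `{1, c}`: the Frattini subgroup of `Gal(K/ℚ)` is
  `≤ ⟨c⟩`, i.e. `K⁺` is a compositum of real quadratic fields (the next file of the programme shows such `K` are never GOOD).

These are the entry points of the case analysis «centre of `2`-rank `≥ 2`» of the order-`32` base; the complementary case («`c` is
the unique central involution», the MINIMAL fields of gen 34) has no CM quotient at all.

## References

* [Dodson1984] B. Dodson, *The structure of Galois groups of CM-fields*, Trans. AMS 283 (1984), §3.3, §5.2.
* [Shimura1998] G. Shimura, *Abelian Varieties with Complex Multiplication and Modular Functions*, §6.2 Thm. 3, §8.2 Prop. 26.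
* [Kubota1965] T. Kubota, *On the field extension by complex multiplication*, Trans. AMS 118 (1965), §2 and §4 Lemma 2.
* [Gordon1999HodgeAVSurvey] B. B. Gordon, *A survey of the Hodge conjecture for abelian varieties*, Thm. 6.4, §9.4.
-/

noncomputable section

open CategoryTheory CategoryTheory.Limits NumberField
open scoped BigOperators

namespace Summit.HodgeConjecture.CorCM.GaloisModels

open Literature.NumberTheory.ComplexMultiplication
open Literature.AlgebraicGeometry.Motives (AbelianVariety CMType)
open Literature.AlgebraicGeometry.HodgeTheory
open Literature.AlgebraicGeometry.Pohlmann1968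
open Summit.HodgeConjecture.CorCM.GaloisRank

section Field

variable {K : Type} [Field K] [NumberField K] [IsCMField K] [IsGalois ℚ K]

/-- **GOOD16 pulled back along a central involution.**  `K` Galois CM of degree `32`, every primitive CM type nondegenerate,
`t ∈ Gal(K/ℚ)` a central involution with `t ∉ {1, c}` (`c` = complex conjugation).  Then either every `g ∈ Gal(K/ℚ)` satisfies
`g² ∈ {1, c, t, c t}`, or some `r ∈ Gal(K/ℚ)` of order `8` has `r⁴ ∈ {c, c t}` and all its conjugates in `{r, r⁻¹, r t, r⁻¹ t}`
(the degree-`16` classification of the GOOD Galois CM subfield `K^⟨t⟩`, read in `Gal(K/ℚ)`).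
[cite: Dodson1984, §3.3 and §5.2] [cite: Shimura1998, §6.2 Thm. 3 and §8.2 Prop. 26] [cite: Kubota1965, §2 and §4 Lemma 2]
[cite: Gordon1999HodgeAVSurvey, Thm. 6.4 and §9.4] -/
theorem sq_mem_or_exists_order_eight_of_central_involution (hdeg : Module.finrank ℚ K = 32)
    (hgood : ∀ (Φ : CMType K) (φ : K →+* ℂ), IsPrimitive (ℂ ≃+* ℂ) Φ.1 φ → IsNondegenerate Φ)
    (t : K ≃ₐ[ℚ] K) (htt : t * t = 1) (ht1 : t ≠ 1) (htc : t ≠ (IsCMField.complexConj K).restrictScalars ℚ)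
    (htcen : ∀ g : K ≃ₐ[ℚ] K, g * t = t * g) :
    (∀ g : K ≃ₐ[ℚ] K, g * g = 1 ∨ g * g = (IsCMField.complexConj K).restrictScalars ℚ ∨ g * g = t ∨
        g * g = (IsCMField.complexConj K).restrictScalars ℚ * t) ∨
    (∃ r : K ≃ₐ[ℚ] K, orderOf r = 8 ∧
        (r ^ 4 = (IsCMField.complexConj K).restrictScalars ℚ ∨ r ^ 4 = (IsCMField.complexConj K).restrictScalars ℚ * t) ∧
        ∀ g : K ≃ₐ[ℚ] K, g * r * g⁻¹ = r ∨ g * r * g⁻¹ = r⁻¹ ∨ g * r * g⁻¹ = r * t ∨ g * r * g⁻¹ = r⁻¹ * t) := by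
  classical
  set c := (IsCMField.complexConj K).restrictScalars ℚ with hc
  have hcc : c * c = 1 := model_complexConj_mul_self (MulEquiv.refl (K ≃ₐ[ℚ] K)) (by simp [hc])
  have hc1 : c ≠ 1 := model_complexConj_ne_one (MulEquiv.refl (K ≃ₐ[ℚ] K)) (by simp [hc])
  have hcard : Nat.card (K ≃ₐ[ℚ] K) = 32 := by
    rw [Nat.card_eq_fintype_card, card_model_eq_finrank (MulEquiv.refl (K ≃ₐ[ℚ] K)), hdeg]
  -- the normal subgroup `N = ⟨t⟩ = {1, t}`, `c ∉ N`
  set N := Subgroup.zpowers t with hN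
  have hmemN : ∀ σ : K ≃ₐ[ℚ] K, σ ∈ N ↔ σ = 1 ∨ σ = t := fun σ => by
    rw [hN]; exact mem_zpowers_iff_of_mul_self_eq_one htt σ
  have htN : t ∈ N := (hmemN t).2 (Or.inr rfl)
  haveI hNn : N.Normal := normal_zpowers_of_forall_comm htcen
  have hcN : c ∉ N := fun h => by
    rcases (hmemN c).1 h with h | h
    · exact hc1 h
    · exact htc h.symm
  have hNbot : N ≠ ⊥ := fun h => ht1 (by
    have := htN
    rw [h] at this
    exact Subgroup.mem_bot.1 this)
  have hNidx : N.index = 16 := by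
    have h1 := index_zpowers_mul_two htt ht1
    rw [hcard, show (32 : ℕ) = 16 * 2 by norm_num] at h1
    exact Nat.eq_of_mul_eq_mul_right (by norm_num) h1
  -- the CM quotient `K' = K^N`, Galois CM of degree `16`, GOOD
  set K' := IntermediateField.fixedField N with hK'
  haveI : IsCMField K' := isCMField_fixedField_of_not_mem N hcN
  haveI : IsGalois ℚ K' := IsGalois.of_fixedField_normal_subgroup N
  set res := AlgEquiv.restrictNormalHom (F := ℚ) (K₁ := K) K' with hres
  have hsurj : Function.Surjective res := AlgEquiv.restrictNormalHom_surjective K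
  have hkerN : res.ker = N :=
    (IntermediateField.restrictNormalHom_ker K').trans (IntermediateField.fixingSubgroup_fixedField N)
  have hker : ∀ σ : K ≃ₐ[ℚ] K, res σ = 1 ↔ σ ∈ N := by
    intro σ
    rw [← MonoidHom.mem_ker, hkerN]
  set c' := (IsCMField.complexConj K').restrictScalars ℚ with hc'
  have hresc : res c = c' := by rw [hres, hc, hc']; exact restrictNormalHom_complexConj_of_tower K'
  have hgood' : ∀ (Φ : CMType K') (φ : K' →+* ℂ), IsPrimitive (ℂ ≃+* ℂ) Φ.1 φ → IsNondegenerate Φ :=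
    fun Φ φ hprim => isNondegenerate_of_isPrimitive_of_fixedField_of_ne_bot N hcN hNbot hgood Φ φ hprim
  have hdeg' : Module.finrank ℚ K' = 16 := by rw [hK', finrank_fixedField_eq_index, hNidx]
  obtain ⟨φ₀⟩ := (inferInstance : Nonempty (K' →+* ℂ))
  have hG16 := (GaloisSixteenClassification.forall_isPrimitive_isNondegenerate_iff_good16 hdeg' φ₀).1
    (fun Φ hprim => hgood' Φ φ₀ hprim)
  -- membership in `N` and in `c N` read through `res`
  have hres1 : ∀ σ : K ≃ₐ[ℚ] K, res σ = 1 → σ = 1 ∨ σ = t := fun σ h => (hmemN σ).1 ((hker σ).1 h)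
  have hresc' : ∀ σ : K ≃ₐ[ℚ] K, res σ = c' → σ = c ∨ σ = c * t := by
    intro σ h
    have h1 : res (c⁻¹ * σ) = 1 := by rw [map_mul, map_inv, h, hresc, inv_mul_cancel]
    rcases hres1 _ h1 with h2 | h2
    · left
      rw [inv_mul_eq_one] at h2
      exact h2.symm
    · right
      rw [inv_mul_eq_iff_eq_mul] at h2
      exact h2
  rcases hG16 with hsq | ⟨r', hr'8, hr'4, hr'conj⟩
  · -- first alternative: all squares of `Gal(K'/ℚ)` in `{1, c'}`
    left
    intro g
    rcases hsq (res g) with h | h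
    · rcases hres1 (g * g) (by rw [map_mul, h]) with h1 | h1
      · exact Or.inl h1
      · exact Or.inr (Or.inr (Or.inl h1))
    · rcases hresc' (g * g) (by rw [map_mul, h]) with h1 | h1
      · exact Or.inr (Or.inl h1)
      · exact Or.inr (Or.inr (Or.inr h1))
  · -- second alternative: an element of order `8` with `r'⁴ = c'` and conjugates in `{r', r'⁻¹}`
    right
    obtain ⟨r, hr⟩ := hsurj r'
    have hr4 : r ^ 4 = c ∨ r ^ 4 = c * t := hresc' (r ^ 4) (by rw [map_pow, hr, hr'4])
    have hct1 : c * t ≠ 1 := by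
      intro h
      apply htc
      have : t = c⁻¹ := eq_inv_of_mul_eq_one_right h
      rw [this]
      exact inv_eq_of_mul_eq_one_right hcc
    have hr4ne : r ^ 4 ≠ 1 := by
      rcases hr4 with h | h <;> rw [h]
      · exact hc1
      · exact hct1
    have hctsq : c * t * (c * t) = 1 := by
      calc c * t * (c * t) = c * (t * c) * t := by group
        _ = c * (c * t) * t := by rw [htcen c]
        _ = (c * c) * (t * t) := by group
        _ = 1 := by rw [hcc, htt, one_mul]
    have hr8 : r ^ 8 = 1 := by
      rw [show r ^ 8 = r ^ 4 * r ^ 4 by rw [← pow_add]]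
      rcases hr4 with h | h <;> rw [h]
      · exact hcc
      · exact hctsq
    have hor : orderOf r = 8 := by
      have h := orderOf_eq_prime_pow (p := 2) (n := 2) (x := r) (by rw [show 2 ^ 2 = 4 by norm_num]; exact hr4ne)
        (by rw [show 2 ^ (2 + 1) = 8 by norm_num]; exact hr8)
      rw [h]; norm_num
    refine ⟨r, hor, hr4, fun g => ?_⟩
    rcases hr'conj (res g) with h | h
    · -- `res (g r g⁻¹) = r'` ⟹ `g r g⁻¹ r⁻¹ ∈ N`
      have h1 : res (g * r * g⁻¹ * r⁻¹) = 1 := by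
        rw [map_mul, map_inv, map_mul, map_inv, map_mul, hr, h, mul_inv_cancel]
      rcases hres1 _ h1 with h2 | h2
      · exact Or.inl (mul_inv_eq_one.1 h2)
      · right; right; left
        rw [mul_inv_eq_iff_eq_mul] at h2
        rw [h2]
        exact (htcen r).symm
    · -- `res (g r g⁻¹) = r'⁻¹` ⟹ `g r g⁻¹ r ∈ N`
      have h1 : res (g * r * g⁻¹ * r) = 1 := by
        rw [map_mul, map_mul, map_inv, map_mul, hr, h, inv_mul_cancel]
      rcases hres1 _ h1 with h2 | h2
      · right; left
        exact mul_eq_one_iff_eq_inv.1 h2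
      · right; right; right
        have h3 : g * r * g⁻¹ = t * r⁻¹ := by
          rw [← h2, mul_inv_cancel_right]
        rw [h3]
        exact (htcen r⁻¹).symm

/-- **Three independent central involutions and exponent `4` ⟹ all squares in `{1, c}`.**  `K` Galois CM of degree `32`, GOOD,
`Gal(K/ℚ)` of exponent `4` (`g⁴ = 1` for all `g`), `t₁, t₂` central involutions with `t₁, t₂ ∉ {1, c}` and `t₂ ∉ {t₁, c t₁}`.  Then
`g² ∈ {1, c}` for every `g` — the Frattini subgroup of `Gal(K/ℚ)` lies in `⟨c⟩`, i.e. the maximal real subfield `K⁺` is a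
compositum of real quadratic fields. [cite: Dodson1984, §3.3 and §5.2] [cite: Shimura1998, §8.2 Prop. 26]
[cite: Kubota1965, §2 and §4 Lemma 2] -/
theorem sq_eq_one_or_eq_of_two_central_involutions (hdeg : Module.finrank ℚ K = 32)
    (hgood : ∀ (Φ : CMType K) (φ : K →+* ℂ), IsPrimitive (ℂ ≃+* ℂ) Φ.1 φ → IsNondegenerate Φ)
    (hexp : ∀ g : K ≃ₐ[ℚ] K, g ^ 4 = 1)
    (t₁ t₂ : K ≃ₐ[ℚ] K) (ht₁ : t₁ * t₁ = 1) (ht₁1 : t₁ ≠ 1) (ht₁c : t₁ ≠ (IsCMField.complexConj K).restrictScalars ℚ)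
    (ht₁cen : ∀ g : K ≃ₐ[ℚ] K, g * t₁ = t₁ * g)
    (ht₂ : t₂ * t₂ = 1) (ht₂1 : t₂ ≠ 1) (ht₂c : t₂ ≠ (IsCMField.complexConj K).restrictScalars ℚ)
    (ht₂cen : ∀ g : K ≃ₐ[ℚ] K, g * t₂ = t₂ * g)
    (h₁₂ : t₂ ≠ t₁) (h₁₂c : t₂ ≠ (IsCMField.complexConj K).restrictScalars ℚ * t₁) (g : K ≃ₐ[ℚ] K) :
    g * g = 1 ∨ g * g = (IsCMField.complexConj K).restrictScalars ℚ := by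
  set c := (IsCMField.complexConj K).restrictScalars ℚ with hc
  have hno8 : ∀ r : K ≃ₐ[ℚ] K, orderOf r ≠ 8 := by
    intro r h
    have h1 : orderOf r ∣ 4 := orderOf_dvd_of_pow_eq_one (hexp r)
    rw [h] at h1
    omega
  rcases sq_mem_or_exists_order_eight_of_central_involution hdeg hgood t₁ ht₁ ht₁1 ht₁c ht₁cen with hA | ⟨r, hr8, -⟩
  · rcases sq_mem_or_exists_order_eight_of_central_involution hdeg hgood t₂ ht₂ ht₂1 ht₂c ht₂cen with hB | ⟨r, hr8, -⟩
    · rcases hA g with h | h | h | h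
      · exact Or.inl h
      · exact Or.inr h
      · rcases hB g with h' | h' | h' | h'
        · exact Or.inl h'
        · exact Or.inr h'
        · exact absurd (h.symm.trans h') h₁₂.symm
        · -- `t₁ = c t₂` ⟹ `t₂ = c t₁`
          exfalso
          apply h₁₂c
          have hcc : c * c = 1 := model_complexConj_mul_self (MulEquiv.refl (K ≃ₐ[ℚ] K)) (by simp [hc])
          have : t₁ = c * t₂ := h.symm.trans h'
          rw [this, ← mul_assoc, hcc, one_mul]
      · rcases hB g with h' | h' | h' | h'
        · exact Or.inl h'
        · exact Or.inr h'
        · -- `c t₁ = t₂`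
          exact absurd (h'.symm.trans h) h₁₂c
        · exfalso
          apply h₁₂
          have hcc : c * c = 1 := model_complexConj_mul_self (MulEquiv.refl (K ≃ₐ[ℚ] K)) (by simp [hc])
          have h2 : c * t₁ = c * t₂ := h.symm.trans h'
          have := congrArg (fun x => c * x) h2
          simp only [← mul_assoc, hcc, one_mul] at this
          exact this.symm
    · exact absurd hr8 (hno8 r)
  · exact absurd hr8 (hno8 r)

end Field

end Summit.HodgeConjecture.CorCM.GaloisModels

end
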